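import Summits.QuantumFields.YangMills.Theorems.FemtoTransferGap
import Mathlib.Analysis.Complex.Exponential
import Mathlib.Analysis.Real.Pi.Bounds
import HarnessLib

/-!
# Route `LuscherReduction`, item `DressedRitz` (stmt-QuantumFields-20205), line «polyakovlift» r7, stub S-PSCAL″ — PARAMETER FACTS for the quantifier shell
# (F9 layer D5b, part 1; LEAD prover ym-lead-20205-polyakovlift g2)

The shell of `PScalingExistsForL (TransplantBasisLR k)` fixes, for `0 < Λ ≤ 1/8` and `L ≥ 4`: the coupling `B = 2L³/Λ³`, the chart scale `μ = Λ/(2L)`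
(`Bμ³ = 1/4`, `bareLambda B = 2μ`), the observable radius `R = √√(1/Λ)` (`R⁴Λ = 1`) and the vacuum radius `R_v = 2/Λ`.  This file collects the elementary
facts about these numbers that the analytic packages consume: `radiusR_pow_four`, `one_le_radiusR`, `radiusR_mul_le` (`RΛ ≤ 1/4`), `radiusR_le_inv` (`R ≤ 1/Λ`),
`sqrt_two_mul_radiusR_le` (`√2R ≤ 2/Λ`), `sqrt_two_mul_radiusV_mul_lt_pi` (`√2·(2/Λ)·Λ < π`), `radiusR_le_window`/`radiusV_le_window`, `coupling_mul_cube` (`Bμ³ = 1/4`),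
`coupling_pos`, `le_coupling_of_le`, `scale_le_eighth`, `exp_neg_radiusR_le` (`e^{−R} ≤ 12!·Λ³`).

HONEST FRAMING: arithmetic; nothing here bears on infinite volume, the continuum limit or the Clay gap.
References: M. Lüscher, NPB 219 (1983) 233 [cite: Luscher1983, §2].
-/

set_option autoImplicit false

noncomputable section

open Real

namespace Summit.QuantumFields.YangMills.Theorems.FemtoTransferGap.PScal

/-- The observable radius of the shell: `R(Λ) = √√(1/Λ) = Λ^{−1/4}`. [cite: Luscher1983, §2] -/
def radiusR (Λ : ℝ) : ℝ := Real.sqrt (Real.sqrt (1 / Λ))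

/-- `R⁴ = 1/Λ` (`Λ > 0`). [folklore] -/
theorem radiusR_pow_four {Λ : ℝ} (hΛ : 0 < Λ) : radiusR Λ ^ 4 = 1 / Λ := by
  unfold radiusR
  rw [show (4 : ℕ) = 2 * 2 from rfl, pow_mul, Real.sq_sqrt (Real.sqrt_nonneg _), Real.sq_sqrt (by positivity)]

/-- `R⁴·Λ = 1`. [folklore] -/
theorem radiusR_pow_four_mul {Λ : ℝ} (hΛ : 0 < Λ) : radiusR Λ ^ 4 * Λ = 1 := by
  rw [radiusR_pow_four hΛ]; field_simp

/-- `0 ≤ R`. [folklore] -/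
theorem radiusR_nonneg (Λ : ℝ) : 0 ≤ radiusR Λ := Real.sqrt_nonneg _

/-- `1 ≤ R` for `0 < Λ ≤ 1`. [folklore] -/
theorem one_le_radiusR {Λ : ℝ} (hΛ : 0 < Λ) (hΛ1 : Λ ≤ 1) : 1 ≤ radiusR Λ := by
  by_contra h
  push Not at h
  have h4 : radiusR Λ ^ 4 < 1 := by
    calc radiusR Λ ^ 4 < 1 ^ 4 := pow_lt_pow_left₀ h (radiusR_nonneg Λ) (by norm_num)
      _ = 1 := one_pow 4
  rw [radiusR_pow_four hΛ] at h4
  have : (1 : ℝ) ≤ 1 / Λ := by rw [le_div_iff₀ hΛ]; linarith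
  linarith

/-- `R ≤ R⁴ = 1/Λ` for `0 < Λ ≤ 1`. [folklore] -/
theorem radiusR_le_inv {Λ : ℝ} (hΛ : 0 < Λ) (hΛ1 : Λ ≤ 1) : radiusR Λ ≤ 1 / Λ := by
  rw [← radiusR_pow_four hΛ]
  have h1 := one_le_radiusR hΛ hΛ1
  calc radiusR Λ = radiusR Λ ^ 1 := (pow_one _).symm
    _ ≤ radiusR Λ ^ 4 := pow_le_pow_right₀ h1 (by norm_num)

/-- `R·Λ ≤ 1/4` for `0 < Λ ≤ 1/8` (`(RΛ)⁴ = Λ³ ≤ 1/512 ≤ (1/4)⁴`). [folklore] -/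
theorem radiusR_mul_le {Λ : ℝ} (hΛ : 0 < Λ) (hΛ8 : Λ ≤ 1 / 8) : radiusR Λ * Λ ≤ 1 / 4 := by
  have hx0 : 0 ≤ radiusR Λ * Λ := mul_nonneg (radiusR_nonneg Λ) hΛ.le
  have hx4 : (radiusR Λ * Λ) ^ 4 ≤ (1 / 4 : ℝ) ^ 4 := by
    have e : (radiusR Λ * Λ) ^ 4 = Λ ^ 3 := by rw [mul_pow, radiusR_pow_four hΛ]; field_simp
    rw [e]
    calc Λ ^ 3 ≤ (1 / 8 : ℝ) ^ 3 := pow_le_pow_left₀ hΛ.le hΛ8 3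
      _ ≤ (1 / 4 : ℝ) ^ 4 := by norm_num
  exact le_of_pow_le_pow_left₀ (by norm_num) (by norm_num) hx4

/-- `√2·R ≤ 2/Λ` (the observable ball sits inside the vacuum cut-off `R_v = 2/Λ`) for `0 < Λ ≤ 1`. [folklore] -/
theorem sqrt_two_mul_radiusR_le {Λ : ℝ} (hΛ : 0 < Λ) (hΛ1 : Λ ≤ 1) : Real.sqrt 2 * radiusR Λ ≤ 2 / Λ := by
  have hs : Real.sqrt 2 ≤ 2 := by
    rw [show (2 : ℝ) = Real.sqrt 4 from by rw [show (4 : ℝ) = 2 ^ 2 by norm_num, Real.sqrt_sq (by norm_num)]]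
    exact Real.sqrt_le_sqrt (by norm_num)
  have h := radiusR_le_inv hΛ hΛ1
  calc Real.sqrt 2 * radiusR Λ ≤ 2 * (1 / Λ) := mul_le_mul hs h (radiusR_nonneg Λ) (by norm_num)
    _ = 2 / Λ := by ring

/-- `√2·(2/Λ)·Λ = 2√2 < π` (the vacuum ball lies inside the injectivity region of `U ↦ U^L`). [folklore] -/
theorem sqrt_two_mul_radiusV_mul_lt_pi {Λ : ℝ} (hΛ : 0 < Λ) : Real.sqrt 2 * (2 / Λ) * Λ < π := by
  have e : Real.sqrt 2 * (2 / Λ) * Λ = 2 * Real.sqrt 2 := by field_simp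
  rw [e]
  have hs : Real.sqrt 2 < 3 / 2 := by
    rw [show (3 / 2 : ℝ) = Real.sqrt ((3 / 2) ^ 2) from (Real.sqrt_sq (by norm_num)).symm]
    exact Real.sqrt_lt_sqrt (by norm_num) (by norm_num)
  linarith [Real.pi_gt_three]

/-- `R ≤ 1/(8μ) = L/(4Λ)` as soon as `L ≥ 4` (`0 < Λ ≤ 1`). [folklore] -/
theorem radiusR_le_window {Λ : ℝ} (hΛ : 0 < Λ) (hΛ1 : Λ ≤ 1) {L : ℕ} (hL : 4 ≤ L) : radiusR Λ ≤ 1 / (8 * (Λ / (2 * L))) := by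
  have hL' : (4 : ℝ) ≤ L := by exact_mod_cast hL
  have h := radiusR_le_inv hΛ hΛ1
  have e : 1 / (8 * (Λ / (2 * (L : ℝ)))) = (L : ℝ) / 4 * (1 / Λ) := by field_simp; ring
  rw [e]
  calc radiusR Λ ≤ 1 * (1 / Λ) := by rw [one_mul]; exact h
    _ ≤ (L : ℝ) / 4 * (1 / Λ) := mul_le_mul_of_nonneg_right (by linarith) (by positivity)

/-- `R_v = 2/Λ ≤ 1/(8μ) = L/(4Λ)` as soon as `L ≥ 8`. [folklore] -/
theorem radiusV_le_window {Λ : ℝ} (hΛ : 0 < Λ) {L : ℕ} (hL : 8 ≤ L) : 2 / Λ ≤ 1 / (8 * (Λ / (2 * L))) := by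
  have hL' : (8 : ℝ) ≤ L := by exact_mod_cast hL
  have e : 1 / (8 * (Λ / (2 * (L : ℝ)))) = (L : ℝ) / 4 * (1 / Λ) := by field_simp; ring
  rw [e, div_eq_mul_one_div 2 Λ]
  exact mul_le_mul_of_nonneg_right (by linarith) (by positivity)

/-- The coupling is positive: `0 < 2L³/Λ³`. [folklore] -/
theorem coupling_pos {Λ : ℝ} (hΛ : 0 < Λ) {L : ℕ} (hL : 0 < L) : 0 < 2 * (L : ℝ) ^ 3 / Λ ^ 3 := by
  have : (0 : ℝ) < L := by exact_mod_cast hL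
  positivity

/-- `Bμ³ = 1/4` for `B = 2L³/Λ³`, `μ = Λ/(2L)`. [cite: Luscher1983, §2] -/
theorem coupling_mul_cube {Λ : ℝ} (hΛ : 0 < Λ) {L : ℕ} (hL : 0 < L) :
    2 * (L : ℝ) ^ 3 / Λ ^ 3 * (Λ / (2 * L)) ^ 3 = 1 / 4 := by
  have : (0 : ℝ) < L := by exact_mod_cast hL
  field_simp
  ring

/-- The coupling dominates `2L³` when `Λ ≤ 1`, hence exceeds any threshold for `L` large. [folklore] -/
theorem le_coupling_of_le {Λ : ℝ} (hΛ : 0 < Λ) (hΛ1 : Λ ≤ 1) {L : ℕ} {B₁ : ℝ} (hB₁ : B₁ ≤ 2 * (L : ℝ) ^ 3) :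
    B₁ ≤ 2 * (L : ℝ) ^ 3 / Λ ^ 3 := by
  have hL0 : (0 : ℝ) ≤ 2 * (L : ℝ) ^ 3 := by positivity
  have hΛ3 : Λ ^ 3 ≤ 1 := by
    calc Λ ^ 3 ≤ 1 ^ 3 := pow_le_pow_left₀ hΛ.le hΛ1 3
      _ = 1 := one_pow 3
  have hΛ3pos : 0 < Λ ^ 3 := pow_pos hΛ 3
  calc B₁ ≤ 2 * (L : ℝ) ^ 3 := hB₁
    _ = 2 * (L : ℝ) ^ 3 / 1 := (div_one _).symm
    _ ≤ 2 * (L : ℝ) ^ 3 / Λ ^ 3 := div_le_div_of_nonneg_left hL0 hΛ3pos hΛ3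

/-- The scale is small: `μ = Λ/(2L) ≤ 1/8` for `Λ ≤ 1`, `L ≥ 4`. [folklore] -/
theorem scale_le_eighth {Λ : ℝ} (hΛ1 : Λ ≤ 1) {L : ℕ} (hL : 4 ≤ L) : Λ / (2 * (L : ℝ)) ≤ 1 / 8 := by
  have hL' : (4 : ℝ) ≤ L := by exact_mod_cast hL
  rw [div_le_iff₀ (by positivity)]
  linarith

/-- The observable tail is super-polynomially small: `e^{−R} ≤ 12!·Λ³` (from `e^{−R} ≤ 12!/R¹²`, `R⁴ = 1/Λ`). [folklore] -/
theorem exp_neg_radiusR_le {Λ : ℝ} (hΛ : 0 < Λ) (hΛ1 : Λ ≤ 1) : Real.exp (-radiusR Λ) ≤ (Nat.factorial 12 : ℝ) * Λ ^ 3 := by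
  have hR : 0 < radiusR Λ := lt_of_lt_of_le one_pos (one_le_radiusR hΛ hΛ1)
  have h : Real.exp (-radiusR Λ) ≤ (Nat.factorial 12 : ℝ) / radiusR Λ ^ 12 := by
    have h0 := Real.pow_div_factorial_le_exp (radiusR Λ) hR.le 12
    rw [Real.exp_neg, inv_le_comm₀ (Real.exp_pos _) (by positivity), inv_div]
    exact h0
  have e : radiusR Λ ^ 12 = (1 / Λ) ^ 3 := by rw [show (12 : ℕ) = 4 * 3 from rfl, pow_mul, radiusR_pow_four hΛ]
  rw [e] at h
  have e2 : ((Nat.factorial 12 : ℕ) : ℝ) / (1 / Λ) ^ 3 = (Nat.factorial 12 : ℝ) * Λ ^ 3 := by field_simp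
  rw [e2] at h
  exact h

end Summit.QuantumFields.YangMills.Theorems.FemtoTransferGap.PScal

end
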